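import Literature.Algebra.EuclideanLattices.LatticeProblems
import HarnessLib

/-!
# The GMSS reduction `GapSVP_γ → GapCVP_γ` proved: discharge of `gapSVP_reduces_to_gapCVP`

Topic `Algebra/EuclideanLattices` (family `pqc`, trunk T-LATTICE), namespace `Literature.PQC`.
Sibling proof file of `LatticeProblems.lean` (which stays untouched: it is upstream of
`LatticeComplexity.lean` and of the whole lattice-cryptography cluster). It DISCHARGES the named
fact `Literature.Algebra.EuclideanLattices.gapSVP_reduces_to_gapCVP` of that file:

* `Literature.PQC.gapSVP_reduces_to_gapCVP_holds : gapSVP_reduces_to_gapCVP` — Goldreich–Micciancio–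
  Safra–Seifert, *Approximating shortest lattice vectors is not harder than approximating
  closest lattice vectors*, IPL 71 (1999), Thm. 1 / §3 (the mathematical content of the
  deterministic Cook reduction `GapSVP_γ → GapCVP_γ`, same dimension, same factor); restated
  and reused as Lemma 5.22 of Micciancio–Regev, SIAM J. Comput. 37 (2007) (authors' version
  p. 27), whose `GapCVP′` refinement (Def. 5.21 and the NO direction for odd multiples) is the
  subject of a sibling file `GapCVPPrime.lean` (proposed separately; not needed here).
* `Literature.Algebra.EuclideanLattices.usvp_promise_iff_holds : usvp_promise_iff` — discharge
  of the sanity fact `usvp_promise_iff` of `LatticeProblems.lean`: the `uSVP_γ` promise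
  `USVP.Promise γ B` (defined with `minNorm`) unfolded with `λ₁` written as the first successive
  minimum, `γ(n) · λ₁(L(B)) ≤ λ₂(L(B))` — the printed form "λ₂(L) ≥ γ · λ₁(L)" of Peikert,
  *A decade of lattice cryptography* (2016), Ch. 3 §3.1, paragraph *Hidden hyperplanes and
  unique-SVP* (author version p. 14); Regev, J. ACM 56 (2009), §1 names unique-SVP as "a special
  case of SVP" without the formula. Proof: `λ₁ = minNorm` in finite dimension
  (`successiveMinimum_one_eq_minNorm_holds`, `SuccessiveMinima.lean`), then `Iff.rfl`.

The proof is the printed one. Write `B⁽ⁱ⁾ = (b₁, …, 2bᵢ, …, bₙ)` (`doubleRow`). Then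
`L(B⁽ⁱ⁾) = {∑ zⱼ bⱼ : zᵢ even}` (`mem_doubleRowLattice_iff`), so `bᵢ - L(B⁽ⁱ⁾)` consists of
vectors of `L(B)` with odd `i`-th coordinate, nonzero when `B` is nonsingular, which gives
`dist(bᵢ, L(B⁽ⁱ⁾)) ≥ λ₁(L(B))` for every `i` (`minNorm_le_infDist_vec_doubleRowLattice`, the NO
direction); and a lattice vector `∑ zⱼ bⱼ ≠ 0` may be halved until some coordinate `zᵢ` is odd
without increasing its norm (`exists_eq_two_pow_smul_odd`, `exists_odd_coeff_norm_le`), after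
which `bᵢ - (bᵢ - ∑ zⱼ bⱼ)`, i.e. `bᵢ - L(B⁽ⁱ⁾) ∋ ∑ zⱼ bⱼ`-type vectors give
`minᵢ dist(bᵢ, L(B⁽ⁱ⁾)) ≤ λ₁(L(B))` (`exists_infDist_vec_doubleRowLattice_le_minNorm`, the YES
direction; approximate minimisers suffice, no shortest vector is needed, so no discreteness
argument is used). The dimension bookkeeping `B⁽ⁱ⁾.n = B.n` holds by `rfl`;
`doubleRowLattice I i` records `L(B⁽ⁱ⁾)` as a sublattice of the ambient space of `L(B)` (this
fixes the syntactic form of the ambient type for rewriting).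

## References

* O. Goldreich, D. Micciancio, S. Safra, J.-P. Seifert, *Approximating shortest lattice vectors
  is not harder than approximating closest lattice vectors*, Inform. Process. Lett. 71 (1999)
  55–61, Thm. 1 and §3 [GoldreichMicciancioSafraSeifert1999].
* D. Micciancio, O. Regev, *Worst-case to average-case reductions based on Gaussian measures*,
  SIAM J. Comput. 37 (2007) 267–302; authors' full version, Lemma 5.22 (p. 27)
  [MicciancioRegev2007].
* D. Micciancio, S. Goldwasser, *Complexity of Lattice Problems*, Kluwer 2002, Ch. 1 §1.2
  [MicciancioGoldwasser2002].
* C. Peikert, *A decade of lattice cryptography*, Found. Trends Theor. Comput. Sci. 10 (2016)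
  283–424, Ch. 3 §3.1 (uSVP_γ: `λ₂(L) ≥ γ · λ₁(L)`) [PeikertDecade2016].
* O. Regev, *On lattices, learning with errors, random linear codes, and cryptography*, J. ACM 56
  (2009), Art. 34, §1 [RegevLWE2009].
-/

noncomputable section

namespace Literature.Algebra.EuclideanLattices

open Metric Finset

/-- `L(B⁽ⁱ⁾)` as a sublattice of the ambient space `ℝⁿ` of `L(B)` (the two ambient types agree
by `rfl`, `(doubleRow I i).n = I.n`; this abbreviation fixes the syntactic form). [cite: GoldreichMicciancioSafraSeifert1999, §3] -/
def doubleRowLattice (I : LatticeInstance) (i : Fin I.n) :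
    Submodule ℤ (EuclideanSpace ℝ (Fin I.n)) :=
  (doubleRow I i).lattice

/-- `doubleRowLattice I i` is literally `L(B⁽ⁱ⁾)`. [cite: GoldreichMicciancioSafraSeifert1999, §3] -/
theorem doubleRowLattice_eq (I : LatticeInstance) (i : Fin I.n) :
    doubleRowLattice I i = (doubleRow I i).lattice := rfl

/-- Row-vector products with `B⁽ⁱ⁾` are row-vector products with `B` after doubling the `i`-th
coefficient: `z B⁽ⁱ⁾ = z' B` with `z' = (z₁, …, 2zᵢ, …, zₙ)` (GMSS 1999, §3). [cite: GoldreichMicciancioSafraSeifert1999, §3] -/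
theorem vecMul_doubleRow (I : LatticeInstance) (i : Fin I.n) (z : Fin I.n → ℤ) :
    Matrix.vecMul z (doubleRow I i).basis = Matrix.vecMul (Function.update z i (2 * z i)) I.basis := by
  change Matrix.vecMul z (I.basis.updateRow i ((2 : ℤ) • I.basis i)) = _
  funext j
  simp only [Matrix.vecMul, dotProduct]
  refine Finset.sum_congr rfl fun k _ => ?_
  rw [Matrix.updateRow_apply, Function.update_apply]
  by_cases h : k = i
  · subst h
    simp only [if_true, Pi.smul_apply, smul_eq_mul]
    ring
  · simp only [if_neg h]

/-- Integer combinations of the rows of `B⁽ⁱ⁾` are the integer combinations of the rows of `B`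
with the `i`-th coefficient doubled (GMSS 1999, §3). [cite: GoldreichMicciancioSafraSeifert1999, §3] -/
theorem doubleRow_ofCoeffs (I : LatticeInstance) (i : Fin I.n) (z : Fin I.n → ℤ) :
    (doubleRow I i).ofCoeffs z = I.ofCoeffs (Function.update z i (2 * z i)) := by
  exact congrArg (intVecToEuclidean I.n) (vecMul_doubleRow I i z)

/-- `∑ⱼ zⱼ bⱼ` is additive in the coefficient vector. [folklore] -/
theorem ofCoeffs_sub (I : LatticeInstance) (z w : Fin I.n → ℤ) :
    I.ofCoeffs (z - w) = I.ofCoeffs z - I.ofCoeffs w := by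
  simp only [LatticeInstance.ofCoeffs_eq_sum, Pi.sub_apply, sub_smul, Finset.sum_sub_distrib]

/-- `∑ⱼ zⱼ bⱼ` is homogeneous in the coefficient vector. [folklore] -/
theorem ofCoeffs_zsmul (I : LatticeInstance) (c : ℤ) (z : Fin I.n → ℤ) :
    I.ofCoeffs (c • z) = c • I.ofCoeffs z := by
  simp only [LatticeInstance.ofCoeffs_eq_sum, Pi.smul_apply, smul_eq_mul, mul_smul,
    Finset.smul_sum]

/-- The `i`-th unit coefficient vector gives the basis vector `bᵢ`. [folklore] -/
theorem ofCoeffs_single (I : LatticeInstance) (i : Fin I.n) :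
    I.ofCoeffs (Pi.single i 1) = I.vec i := by
  classical
  rw [LatticeInstance.ofCoeffs_eq_sum, Finset.sum_eq_single i]
  · rw [Pi.single_eq_same, one_smul]
  · intro j _ hj
    rw [Pi.single_eq_of_ne hj, zero_smul]
  · exact fun h => (h (Finset.mem_univ i)).elim

/-- For a nonsingular `B` the coefficient vector of a lattice vector is unique: `∑ zⱼ bⱼ = 0`
forces `z = 0` (Micciancio–Goldwasser 2002, Ch. 1, Def. 1.1). [cite: MicciancioGoldwasser2002, Ch. 1  Def. 1.1] -/
theorem ofCoeffs_eq_zero_iff {I : LatticeInstance} (hI : I.IsNonsingular) (z : Fin I.n → ℤ) :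
    I.ofCoeffs z = 0 ↔ z = 0 := by
  constructor
  · intro h
    rw [LatticeInstance.ofCoeffs_eq_sum] at h
    have h' : ∑ j, ((z j : ℤ) : ℝ) • I.vec j = 0 := by
      simpa only [Int.cast_smul_eq_zsmul] using h
    have hli := Fintype.linearIndependent_iff.1 (LatticeInstance.linearIndependent_vec hI) _ h'
    funext j
    exact_mod_cast hli j
  · rintro rfl
    rw [LatticeInstance.ofCoeffs_eq_sum]
    simp

/-- The lattice of `B⁽ⁱ⁾` consists of the vectors `∑ zⱼ bⱼ` of `L(B)` with `zᵢ` even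
(GMSS 1999, §3: `L(B⁽ⁱ⁾) ⊆ L(B)` misses exactly the vectors with odd `i`-th coordinate). [cite: GoldreichMicciancioSafraSeifert1999, §3] -/
theorem mem_doubleRowLattice_iff (I : LatticeInstance) (i : Fin I.n)
    (x : EuclideanSpace ℝ (Fin I.n)) :
    x ∈ doubleRowLattice I i ↔ ∃ z : Fin I.n → ℤ, I.ofCoeffs z = x ∧ Even (z i) := by
  refine ((doubleRow I i).mem_lattice_iff x).trans ⟨?_, ?_⟩
  · rintro ⟨z, hz⟩
    refine ⟨Function.update z i (2 * z i), ((doubleRow_ofCoeffs I i z).symm.trans hz), ?_⟩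
    rw [Function.update_self]
    exact even_two_mul _
  · rintro ⟨z, rfl, ⟨w, hw⟩⟩
    have hz : Function.update (Function.update z i w) i (2 * Function.update z i w i) = z := by
      rw [Function.update_self, Function.update_idem]
      funext j
      by_cases h : j = i
      · subst h; rw [Function.update_self, hw, two_mul]
      · rw [Function.update_of_ne h]
    exact ⟨Function.update z i w, (doubleRow_ofCoeffs I i _).trans (congrArg I.ofCoeffs hz)⟩

/-- `L(B⁽ⁱ⁾) ⊆ L(B)` (GMSS 1999, §3). [cite: GoldreichMicciancioSafraSeifert1999, §3] -/
theorem doubleRowLattice_le (I : LatticeInstance) (i : Fin I.n) :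
    doubleRowLattice I i ≤ I.lattice := by
  intro x hx
  obtain ⟨z, rfl, -⟩ := (mem_doubleRowLattice_iff I i x).1 hx
  exact I.ofCoeffs_mem_lattice z

/-- `λ₁(L) ≤ ‖x‖` for every nonzero `x ∈ L` (Cassels, Geometry of Numbers, Ch. VIII §1). [folklore] -/
theorem minNorm_le_norm_of_mem {n : ℕ} {L : Submodule ℤ (EuclideanSpace ℝ (Fin n))}
    {x : EuclideanSpace ℝ (Fin n)} (hx : x ∈ L) (h0 : x ≠ 0) : minNorm L ≤ ‖x‖ :=
  csInf_le ⟨0, by rintro _ ⟨y, -, rfl⟩; exact norm_nonneg y⟩ ⟨x, ⟨hx, h0⟩, rfl⟩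

/-- The key GMSS observation: for nonsingular `B` and `u ∈ L(B⁽ⁱ⁾)`, the difference `bᵢ - u` is
a NONZERO vector of `L(B)` (its `i`-th coordinate is odd), hence `‖bᵢ - u‖ ≥ λ₁(L(B))`
(GMSS 1999, §3; Micciancio–Regev 2007, proof of Lemma 5.22). [cite: GoldreichMicciancioSafraSeifert1999, §3] -/
theorem minNorm_le_dist_vec_of_mem_doubleRowLattice {I : LatticeInstance} (hI : I.IsNonsingular)
    (i : Fin I.n) {u : EuclideanSpace ℝ (Fin I.n)} (hu : u ∈ doubleRowLattice I i) :
    I.vec i - u ∈ I.lattice ∧ I.vec i - u ≠ 0 ∧ minNorm I.lattice ≤ dist (I.vec i) u := by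
  obtain ⟨z, rfl, hz⟩ := (mem_doubleRowLattice_iff I i u).1 hu
  have hrepr : I.vec i - I.ofCoeffs z = I.ofCoeffs (Pi.single i 1 - z) := by
    rw [ofCoeffs_sub, ofCoeffs_single]
  have hmem : I.vec i - I.ofCoeffs z ∈ I.lattice := hrepr ▸ I.ofCoeffs_mem_lattice _
  have hne : I.vec i - I.ofCoeffs z ≠ 0 := by
    rw [hrepr, Ne, ofCoeffs_eq_zero_iff hI]
    intro h
    have hi := congrFun h i
    simp only [Pi.sub_apply, Pi.single_eq_same, Pi.zero_apply, sub_eq_zero] at hi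
    exact (Int.not_even_iff_odd.2 odd_one) (hi ▸ hz)
  exact ⟨hmem, hne, dist_eq_norm (I.vec i) (I.ofCoeffs z) ▸ minNorm_le_norm_of_mem hmem hne⟩

/-- Consequently `λ₁(L(B)) ≤ dist(bᵢ, L(B⁽ⁱ⁾))` for every `i` when `B` is nonsingular
(GMSS 1999, Thm. 1, NO direction; Micciancio–Regev 2007, proof of Lemma 5.22). [cite: GoldreichMicciancioSafraSeifert1999, Thm. 1] -/
theorem minNorm_le_infDist_vec_doubleRowLattice {I : LatticeInstance} (hI : I.IsNonsingular)
    (i : Fin I.n) : minNorm I.lattice ≤ infDist (I.vec i) (doubleRowLattice I i : Set _) := by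
  by_contra h
  push Not at h
  obtain ⟨u, hu, hlt⟩ := (infDist_lt_iff ⟨0, (doubleRowLattice I i).zero_mem⟩).1 h
  exact (lt_irrefl _) (hlt.trans_le' (minNorm_le_dist_vec_of_mem_doubleRowLattice hI i hu).2.2)

/-- Halving: every nonzero integer vector is `2ᵏ w` for some `w` with an odd coordinate. [folklore] -/
theorem exists_eq_two_pow_smul_odd {n : ℕ} (z : Fin n → ℤ) (hz : z ≠ 0) :
    ∃ (k : ℕ) (w : Fin n → ℤ), z = (2 : ℤ) ^ k • w ∧ ∃ i, Odd (w i) := by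
  suffices H : ∀ (N : ℕ) (z : Fin n → ℤ), z ≠ 0 → ∑ j, (z j).natAbs = N →
      ∃ (k : ℕ) (w : Fin n → ℤ), z = (2 : ℤ) ^ k • w ∧ ∃ i, Odd (w i) from H _ z hz rfl
  intro N
  refine Nat.strong_induction_on N ?_
  intro N ih z hz hN
  by_cases hodd : ∃ i, Odd (z i)
  · exact ⟨0, z, by simp, hodd⟩
  · push Not at hodd
    have hev : ∀ i, ∃ w : ℤ, z i = 2 * w := fun i =>
      (Int.not_odd_iff_even.1 (hodd i)).imp fun w hw => by rw [hw, two_mul]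
    choose w hw using hev
    have hw0 : w ≠ 0 := by
      rintro rfl
      exact hz (funext fun i => by simpa using hw i)
    have hzw : z = (2 : ℤ) • w := funext fun i => by simpa [smul_eq_mul] using hw i
    have hlt : ∑ j, (w j).natAbs < N := by
      have hsum : N = 2 * ∑ j, (w j).natAbs := by
        rw [← hN, Finset.mul_sum]
        exact Finset.sum_congr rfl fun j _ => by rw [hw j, Int.natAbs_mul]; rfl
      have hpos : 0 < ∑ j, (w j).natAbs := by
        by_contra h0
        push Not at h0
        apply hw0
        funext j
        have := (Finset.sum_eq_zero_iff_of_nonneg fun j _ => Nat.zero_le _).1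
          (Nat.le_zero.1 h0) j (Finset.mem_univ j)
        exact Int.natAbs_eq_zero.1 this
      omega
    obtain ⟨k, u, hu, i, hi⟩ := ih _ hlt w hw0 rfl
    refine ⟨k + 1, u, ?_, i, hi⟩
    rw [hzw, hu, smul_smul, ← pow_succ']

/-- Halving inside a lattice: a nonzero vector `x = ∑ zⱼ bⱼ` of `L(B)` is `2ᵏ y` with
`y = ∑ wⱼ bⱼ ∈ L(B)`, `y ≠ 0`, `‖y‖ ≤ ‖x‖` and some `wᵢ` odd (GMSS 1999, proof of Thm. 1: a
shortest vector has an odd coordinate; here for arbitrary nonzero vectors, so that no shortest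
vector is needed). [cite: GoldreichMicciancioSafraSeifert1999, Thm. 1] -/
theorem exists_odd_coeff_norm_le (I : LatticeInstance) {z : Fin I.n → ℤ} (hz : I.ofCoeffs z ≠ 0) :
    ∃ w : Fin I.n → ℤ, (∃ i, Odd (w i)) ∧ I.ofCoeffs w ≠ 0 ∧ ‖I.ofCoeffs w‖ ≤ ‖I.ofCoeffs z‖ := by
  have hz0 : z ≠ 0 := by
    rintro rfl
    apply hz
    rw [LatticeInstance.ofCoeffs_eq_sum]
    simp
  obtain ⟨k, w, rfl, hi⟩ := exists_eq_two_pow_smul_odd z hz0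
  rw [ofCoeffs_zsmul] at hz ⊢
  refine ⟨w, hi, fun h => hz (by rw [h, smul_zero]), ?_⟩
  rw [norm_zsmul ℝ]
  refine le_mul_of_one_le_left (norm_nonneg _) ?_
  rw [Int.cast_pow, norm_pow]
  refine one_le_pow₀ ?_
  rw [Real.norm_eq_abs]
  norm_num

/-- **GMSS 1999, Thm. 1, YES direction** (Micciancio–Regev 2007, proof of Lemma 5.22): if `B` is
nonsingular of positive dimension then `dist(bᵢ, L(B⁽ⁱ⁾)) ≤ λ₁(L(B))` for some `i`. [cite: GoldreichMicciancioSafraSeifert1999, Thm. 1] -/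
theorem exists_infDist_vec_doubleRowLattice_le_minNorm {I : LatticeInstance}
    (hI : I.IsNonsingular) (hn : I.n ≠ 0) :
    ∃ i : Fin I.n, infDist (I.vec i) (doubleRowLattice I i : Set _) ≤ minNorm I.lattice := by
  by_contra hcon
  push Not at hcon
  -- a uniform margin below all the distances
  set δ : Fin I.n → ℝ := fun i =>
    infDist (I.vec i) (doubleRowLattice I i : Set _) - minNorm I.lattice with hδ
  have hδpos : ∀ i, 0 < δ i := fun i => sub_pos.2 (hcon i)
  have hne : (Finset.univ : Finset (Fin I.n)).Nonempty :=
    ⟨⟨0, Nat.pos_of_ne_zero hn⟩, Finset.mem_univ _⟩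
  obtain ⟨i₀, -, hi₀⟩ := Finset.exists_min_image Finset.univ δ hne
  -- an almost shortest nonzero lattice vector
  have hS : ((‖·‖) '' {x : EuclideanSpace ℝ (Fin I.n) | x ∈ I.lattice ∧ x ≠ 0}).Nonempty := by
    let j : Fin I.n := ⟨0, Nat.pos_of_ne_zero hn⟩
    exact ⟨_, ⟨I.vec j, ⟨Submodule.subset_span (Set.mem_range_self j),
      (LatticeInstance.linearIndependent_vec hI).ne_zero j⟩, rfl⟩⟩
  obtain ⟨_, ⟨x, ⟨hxL, hx0⟩, rfl⟩, hxlt⟩ := Real.lt_sInf_add_pos hS (hδpos i₀)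
  change ‖x‖ < minNorm I.lattice + δ i₀ at hxlt
  obtain ⟨z, rfl⟩ := (I.mem_lattice_iff x).1 hxL
  obtain ⟨w, ⟨i, hi⟩, hw0, hwle⟩ := exists_odd_coeff_norm_le I hx0
  -- `bᵢ - y ∈ L(B⁽ⁱ⁾)` for `y = ∑ wⱼ bⱼ` with `wᵢ` odd
  have hmem : I.vec i - I.ofCoeffs w ∈ doubleRowLattice I i := by
    rw [mem_doubleRowLattice_iff]
    refine ⟨Pi.single i 1 - w, by rw [ofCoeffs_sub, ofCoeffs_single], ?_⟩
    simpa using Odd.sub_odd odd_one hi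
  have hdist : infDist (I.vec i) (doubleRowLattice I i : Set _) ≤ ‖I.ofCoeffs w‖ := by
    refine (infDist_le_dist_of_mem hmem).trans_eq ?_
    rw [dist_eq_norm, sub_sub_cancel]
  have hmin := hi₀ i (Finset.mem_univ i)
  have hlt : ‖I.ofCoeffs w‖ < infDist (I.vec i) (doubleRowLattice I i : Set _) := by
    calc ‖I.ofCoeffs w‖ ≤ ‖I.ofCoeffs z‖ := hwle
      _ < minNorm I.lattice + δ i₀ := hxlt
      _ ≤ minNorm I.lattice + δ i := by linarith
      _ = infDist (I.vec i) (doubleRowLattice I i : Set _) := by rw [hδ]; ring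
  exact (lt_irrefl _) (hdist.trans_lt hlt)

/-- Nonsingularity of `B⁽ⁱ⁾` gives back that of `B` (`det B⁽ⁱ⁾ = 2 det B`). [cite: GoldreichMicciancioSafraSeifert1999, §3] -/
theorem isNonsingular_of_doubleRow {I : LatticeInstance} {i : Fin I.n}
    (h : (doubleRow I i).IsNonsingular) : I.IsNonsingular := by
  change (I.basis.updateRow i ((2 : ℤ) • I.basis i)).det ≠ 0 at h
  rw [Matrix.det_updateRow_smul, Matrix.updateRow_eq_self] at h
  exact right_ne_zero_of_mul h

/-- Unfolding the `i`-th GMSS instance as a `GapCVP_γ` YES instance, in the ambient space of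
`L(B)`: `B⁽ⁱ⁾` nonsingular, `d > 0`, `dist(bᵢ, L(B⁽ⁱ⁾)) ≤ d`. [cite: GoldreichMicciancioSafraSeifert1999, §3] -/
theorem gmssInstance_mem_gapCVP_yes_iff (γ : ℕ → ℝ) (I : LatticeInstance) (i : Fin I.n) (d : ℚ) :
    (gmssInstance I i, d) ∈ GapCVP.yes γ ↔ (doubleRow I i).IsNonsingular ∧ 0 < d ∧
      infDist (I.vec i) (doubleRowLattice I i : Set _) ≤ (d : ℝ) :=
  Iff.rfl

/-- Unfolding the `i`-th GMSS instance as a `GapCVP_γ` NO instance, in the ambient space of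
`L(B)`: `B⁽ⁱ⁾` nonsingular, `d > 0`, `γ(n) d < dist(bᵢ, L(B⁽ⁱ⁾))`. [cite: GoldreichMicciancioSafraSeifert1999, §3] -/
theorem gmssInstance_mem_gapCVP_no_iff (γ : ℕ → ℝ) (I : LatticeInstance) (i : Fin I.n) (d : ℚ) :
    (gmssInstance I i, d) ∈ GapCVP.no γ ↔ (doubleRow I i).IsNonsingular ∧ 0 < d ∧
      γ I.n * (d : ℝ) < infDist (I.vec i) (doubleRowLattice I i : Set _) :=
  Iff.rfl

/-- **GMSS 1999, Thm. 1** in the tree's form: DISCHARGE of the named fact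
`gapSVP_reduces_to_gapCVP` (`(B, d) ∈ GapSVP_γ.YES ↔ ∃ i, (B⁽ⁱ⁾, bᵢ, d) ∈ GapCVP_γ.YES` for
`n ≠ 0`, and `(B, d) ∈ GapSVP_γ.NO → ∀ i, (B⁽ⁱ⁾, bᵢ, d) ∈ GapCVP_γ.NO`); this is also
Lemma 5.22 of Micciancio–Regev 2007 (authors' version p. 27) up to its `GapCVP′` refinement of
the NO instances. [cite: GoldreichMicciancioSafraSeifert1999, Thm. 1] -/
theorem gapSVP_reduces_to_gapCVP_holds : gapSVP_reduces_to_gapCVP := by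
  intro γ I hn d
  refine ⟨⟨fun h => ?_, fun ⟨i, hi⟩ => ?_⟩, fun h i => ?_⟩
  · -- YES ⇒ some GMSS instance is YES
    obtain ⟨hI, hd, hmin⟩ := h
    obtain ⟨i, hi⟩ := exists_infDist_vec_doubleRowLattice_le_minNorm hI hn
    exact ⟨i, (gmssInstance_mem_gapCVP_yes_iff γ I i d).2
      ⟨isNonsingular_doubleRow hI i, hd, hi.trans hmin⟩⟩
  · -- some GMSS instance YES ⇒ YES
    obtain ⟨hIi, hd, hdist⟩ := (gmssInstance_mem_gapCVP_yes_iff γ I i d).1 hi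
    have hI : I.IsNonsingular := isNonsingular_of_doubleRow hIi
    refine ⟨hI, hd, le_of_forall_pos_lt_add fun ε hε => ?_⟩
    have hlt : infDist (I.vec i) (doubleRowLattice I i : Set _) < d + ε :=
      lt_of_le_of_lt hdist (lt_add_of_pos_right _ hε)
    obtain ⟨u, hu, hu'⟩ := (infDist_lt_iff ⟨0, (doubleRowLattice I i).zero_mem⟩).1 hlt
    exact (minNorm_le_dist_vec_of_mem_doubleRowLattice hI i hu).2.2.trans_lt hu'
  · -- NO ⇒ every GMSS instance is NO
    obtain ⟨hI, hd, hγ⟩ := h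
    exact (gmssInstance_mem_gapCVP_no_iff γ I i d).2 ⟨isNonsingular_doubleRow hI i, hd,
      hγ.trans_le (minNorm_le_infDist_vec_doubleRowLattice hI i)⟩

/-! ### The `uSVP_γ` promise with `λ₁` as first successive minimum -/

/-- **Discharge of `usvp_promise_iff`.** The `uSVP_γ` promise on an integer lattice instance `B`,
`USVP.Promise γ B` (nonsingular `B` and `γ(n) · minNorm L(B) ≤ λ₂(L(B))`), is equivalent to
`B` nonsingular and `γ(n) · λ₁(L(B)) ≤ λ₂(L(B))` with `λ₁` the first successive minimum — the
printed promise "`λ₂(L) ≥ γ · λ₁(L)`, where `λᵢ` denotes the `i`th successive minimum" of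
Peikert, *A decade of lattice cryptography* (2016), Ch. 3 §3.1, *Hidden hyperplanes and
unique-SVP* (author version p. 14); Regev (J. ACM 2009), §1 refers to unique-SVP as a special case
of SVP. Proof: `λ₁(L) = minNorm L` for every `ℤ`-submodule of the finite-dimensional space `ℝⁿ`
(`successiveMinimum_one_eq_minNorm_holds`), after which both sides agree definitionally.
[cite: PeikertDecade2016, Ch. 3 §3.1] -/
theorem usvp_promise_iff_holds : usvp_promise_iff := by
  intro γ I
  have h1 : successiveMinimum I.lattice 1 = minNorm I.lattice :=
    successiveMinimum_one_eq_minNorm_holds (E := EuclideanSpace ℝ (Fin I.n)) I.lattice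
  rw [h1]
  rfl

end Literature.Algebra.EuclideanLattices

end
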